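import Mathlib
import Summits.Ventures.FusionMHD.Bench.SAlphaS3W55A225Panels
import Summits.Ventures.FusionMHD.Bench.SAlphaS3W55A56Panels
import Literature.MathematicalPhysics.MHD.BallooningSAlphaWitnessInterval
import HarnessLib

/-!
# F3 — THE UNSTABLE BAND OF THE `s–α` MODEL AT SHEAR `s = 3`, CERTIFIED UP TO THE SECOND-STABILITY EDGE: `U₃ ⊇ [9/4, 28/5]` — ONE finite-element
# trial function (window `[−6, 6]`, tuned at `α = 11/2`) is a witness at `α = 9/4` AND at `α = 28/5`, hence — the energy of a fixed trial function
# is a convex quadratic polynomial in `α` (`BallooningSAlphaWitnessInterval.unstableWitness_of_mem_Icc`) — at every `α` between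
(venture LADDER-GRIDFUSION, rung F3; cell `gridfusion`, typed by gridfusion-lit-3 (g14), 2026-08-28.  ONE composition file: 0 `def … : Prop` facts,
0 defs, 0 kit jobs, no `native_decide`, no floating point in any statement; 2 × 12 kernel panel enclosures in the panel files.)

## THREE COLUMNS
CERTIFIED (kernel): in the `s–α` ballooning MODEL (Freidberg (12.96)–(12.99), `Λ = sθ − α sin θ`, `θ₀ = 0`) at shear `s = 3`: for EVERY
`α ∈ [9/4, 28/5]` the explicit trial function `X = Spline.trialX (1/2) 1 SAlphaS3W55.pieces (−6)` (12 quintic pieces, `C²`, dofs in `2⁻²⁴ℤ`,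
`X(±6) = 0`) has NEGATIVE one-surface energy on `[−6, 6]` — `unstableWitness_225` (`W(9/4) ≈ −0.1283`), `unstableWitness_56`
(`W(28/5) ≈ −0.02461`; exact dyadic enclosures in `c225_seg_all` / `c56_seg_all`), then `unstableWitness_band` by convexity in `α`.  So
`U₃ ⊇ [9/4, 28/5] = [2.25, 5.6]`: the band contains the `s = 3` chord `[11/4, 19/4]` of Fundamenski's cosine conic
(`BallooningSAlphaCosineTrialFunction.unstableWitness_cosine_of_neg`) and the top `lensHi 3 = 23/5` of model-7's two-turn lens
(`Models/SAlphaTwoTurnLens`), and its upper end lies `0.014` below the float second edge.  VALIDATED (not in the kernel): shooting edges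
`α₁(3) ≈ 1.810`, `α₂(3) ≈ 5.614`; the function's own float chord `(2.19, 5.613)`.  PAIRING (not imported, not assumed): a certified STABLE point
above the band at `s = 3` — model-7 g9's announced second-stability certificate at `(3, 6)` (`Models/SAlphaSecondStableS3A6*`) — makes
`α₂(3) ∈ (28/5, 6)` a certified bracket of the SECOND edge of the model at `s = 3`.  MODELLED: `s–α` model (large-aspect-ratio shifted circles,
high-`n` ballooning ordering, `θ₀ = 0`, ideal MHD); «unstable» = the model's one-surface functional (12.38)/(12.97) is negative on an explicit
compactly supported differentiable trial function vanishing at the ends of its window (lit-3's witness class, Newcomb sense); representation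
step (Connor–Hastie–Taylor 1979) quoted in `BallooningSAlpha.lean`, not typed; no device, no `β`-limit.  Citations: Freidberg 2014 §12.3
(12.38)–(12.40), §12.6.2 (12.97) [Freidberg2014]; Mahboubi–Melquiond–Sibut-Pinote 2016 §3.2–3.3 [MahboubiMelquiondSibutpinote2016].
-/

open Literature.Analysis.ValidatedNumerics Literature.Analysis.ValidatedNumerics.PolyMP
open Literature.Analysis.ValidatedNumerics.NumericsMP Literature.Analysis.ValidatedNumerics.ExpPoly
open Literature.MathematicalPhysics.MHD.Ballooning Literature.MathematicalPhysics.MHD.Ballooning.SAlpha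
open Literature.MathematicalPhysics.MHD.Ballooning.SAlpha.Spline
open Set

namespace Summit.Ventures.FusionMHD.Bench.SAlphaS3W55

/-- THE GLUED SEGMENT at `α = 9/4` in summed form. [cite: MahboubiMelquiondSibutpinote2016, Sect. 3.3] -/
theorem c225_seg_all :
    FSegOK (splineDensity 3 (9/4) (-6) (1/2) 1 pieces) [1] (2 ^ 60) (panelLeft (1/2) 0) (panelLeft (1/2) 12) (-147882347197366272) (-147882347182686208) := by
  have h := c225_seg
  norm_num at h
  exact h

/-- THE `[-6, 6]` TRIAL FUNCTION IS A WITNESS AT `(3, 9/4)`: `UnstableWitness 3 (9/4) (-6) 6 X X′`, `2⁶⁰·W ≤ -147882347182686208` (`W ≈ -0.1283`;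
enclosure `[-0.1282675, -0.1282675]`). [cite: Freidberg2014, §12.3 eqs. (12.38)–(12.40)] -/
theorem unstableWitness_225 :
    UnstableWitness 3 (9/4) (-6) 6 (trialX (1/2) 1 pieces (-6)) (trialX' (1/2) 1 pieces (-6)) := by
  have h := unstableWitness_of_spline (s := 3) (α := 9/4) (a := -6) (h := 1/2) (m := 1) (ps := pieces)
    (by norm_num : (0:ℚ) < 1/2) one_pos pieces_ne_nil pieces_match pieces_deriv_match head_zero last_zero c225_seg_all (by decide)
  rw [pieces_length] at h
  norm_num at h
  exact h

/-- THE GLUED SEGMENT at `α = 28/5` in summed form. [cite: MahboubiMelquiondSibutpinote2016, Sect. 3.3] -/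
theorem c56_seg_all :
    FSegOK (splineDensity 3 (28/5) (-6) (1/2) 1 pieces) [1] (2 ^ 60) (panelLeft (1/2) 0) (panelLeft (1/2) 12) (-28376066391277568) (-28376066361917440) := by
  have h := c56_seg
  norm_num at h
  exact h

/-- THE `[-6, 6]` TRIAL FUNCTION IS A WITNESS AT `(3, 28/5)`: `UnstableWitness 3 (28/5) (-6) 6 X X′`, `2⁶⁰·W ≤ -28376066361917440` (`W ≈ -0.0246`;
enclosure `[-0.0246123, -0.0246123]`). [cite: Freidberg2014, §12.3 eqs. (12.38)–(12.40)] -/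
theorem unstableWitness_56 :
    UnstableWitness 3 (28/5) (-6) 6 (trialX (1/2) 1 pieces (-6)) (trialX' (1/2) 1 pieces (-6)) := by
  have h := unstableWitness_of_spline (s := 3) (α := 28/5) (a := -6) (h := 1/2) (m := 1) (ps := pieces)
    (by norm_num : (0:ℚ) < 1/2) one_pos pieces_ne_nil pieces_match pieces_deriv_match head_zero last_zero c56_seg_all (by decide)
  rw [pieces_length] at h
  norm_num at h
  exact h

/-- ★★ THE BAND: the `[-6, 6]` trial function is a witness at EVERY `α ∈ [9/4, 28/5]` (the energy of a fixed trial function is a convex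
quadratic polynomial in `α`): `U_{3} ⊇ [9/4, 28/5]`. [cite: Freidberg2014, §12.3 eqs. (12.38)–(12.40)] («… The plasma is unstable», for the band of the MODEL) -/
theorem unstableWitness_band :
    ∀ α ∈ Icc (9/4 : ℝ) (28/5), UnstableWitness 3 α (-6) 6 (trialX (1/2) 1 pieces (-6)) (trialX' (1/2) 1 pieces (-6)) :=
  unstableWitness_of_mem_Icc unstableWitness_225 unstableWitness_56

/-- … hence every point of the band carries SOME witness, [cite: Freidberg2014, §12.3 eqs. (12.38)–(12.40)] -/
theorem exists_unstableWitness_of_mem_band {α : ℝ} (hα : α ∈ Icc (9/4 : ℝ) (28/5)) :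
    ∃ a b : ℝ, ∃ X X' : ℝ → ℝ, UnstableWitness 3 α a b X X' :=
  ⟨_, _, _, _, unstableWitness_band α hα⟩

/-- … and none is on the stable side. [cite: Freidberg2014, §12.3 eq. (12.40)] -/
theorem not_stableSide_of_mem_band {α : ℝ} (hα : α ∈ Icc (9/4 : ℝ) (28/5)) : ¬ StableSide 3 α := by
  obtain ⟨a, b, X, X', hw⟩ := exists_unstableWitness_of_mem_band hα
  exact fun hs => hs a b X X' hw

end Summit.Ventures.FusionMHD.Bench.SAlphaS3W55
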